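import Mathlib
import Summits.KontsevichZagierPeriods.KontsevichZagierPeriods.Theorems.InverseLandauTateFamilyKernelStubQhFaceMoments

/-!
# Crux `TateFamilyKernel` (stmt-KontsevichZagierPeriods-9130), line `Sketch`:
# stub `stub_faceSeriesVanishing` (wave 15 — the telescoped face family has vanishing integrals
# near the Tate point)

Data (variables `X 0 = s`, `X 1 = ϖ`): weights `a, b, d`, `T, P_w ∈ ℚ[z₀,z₁]` (`w ∈ W`), and the
two one-face `θ`-towers `NAs w`, `NBs w`: level `0` is `a·P_w(1,s)` (resp. `b·P_w(s,1)`) and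
level `i+1 = ϖ(∂_ϖN_i·D − (i+1)N_i∂_ϖD)`, `D = D_a = 1 − ϖT(1,s)` (resp. `D_b = 1 − ϖT(s,1)`), so
that `N_{i+1}/D^{i+2} = ϖ∂_ϖ(N_i/D^{i+1})`. Hypothesis: the telescoped face moments
`∫₀¹ Σ_w (∏_{v≠w}(λ_v + dk))·[a(P_wT^k)(1,s) + b(P_wT^k)(s,1)] ds` vanish (`λ_v = v + a + b`).
Conclusion: for `ϖ ∈ (0,b₁)`, `D_a, D_b ≠ 0` on `[0,1]` and
`∫₀¹ Σ_w Σ_{i<#W} e_{w,i} d^i [NAs w i/D_a^{i+1} + NBs w i/D_b^{i+1}](s,ϖ) ds = 0`,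
`e_w = ∏_{v≠w}(X + λ_v)`.

Proof. With `M ≥ |T(1,s)|, |T(s,1)|` on `[0,1]` and `b₁ = 1/(M+1)`:
* level `i` of a face tower is the power series `Σ_k k^i·aP_w(1,s)T(1,s)^k·ϖ^k` on `(−b₁,b₁)`
  (`FaceSeriesVanishing.hasSum_level`): level `0` is geometric, and `ϖ·d/dϖ` acts termwise
  (`FaceSeriesVanishing.hasSum_mul_deriv`: `hasDerivAt_tsum_of_isPreconnected` + uniqueness of
  the derivative, the derivative of the level being computed by the quotient rule and the
  recursion);
* `Σ_{i<#W} e_{w,i}(dk)^i = e_w(dk) = ∏_{v≠w}(λ_v + dk)` (`Polynomial.eval_eq_sum_range'`), so the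
  integrand is `Σ_k ϖ^k H_k(s)` with `H_k` the `k`-th face-moment integrand
  (`FaceSeriesVanishing.expand_eq`), dominated by the summable
  `ϖ^k M^k Σ_w (∏_{v≠w}(λ_v + dk))(aK_w + bK_w)` (`FaceSeriesVanishing.summable_bound`);
* termwise integration (`intervalIntegral.hasSum_integral_of_dominated_convergence`) gives
  `∫ = Σ_k ϖ^k·0 = 0`.

References: Kontsevich–Zagier 2001, §1.2 (an elementary real-analysis step of one test class of
the period conjecture). Mathlib plus the landed sibling `…StubQhFaceMoments` (slice calculus
`QhFaceMoments.hasDerivAt_aeval_right`, `QhFaceMoments.continuous_aeval_vec`); no named fact, no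
new definition. Helpers live in the sub-namespace `FaceSeriesVanishing`.
-/

noncomputable section

open MeasureTheory Set MvPolynomial
open scoped Topology

namespace Summit.KontsevichZagierPeriods.InverseLandau.TateFamilyKernel.Descent

namespace FaceSeriesVanishing

/-! ### Termwise `y · d/dy` of a real power series -/

/-- **Termwise `y·d/dy` of a real power series.** If `Σ_k u_k z^k = f(z)` on `(-r, r)` (`0 < r`),
`Σ_k k |u_k| r^k < ∞`, `y ∈ (-r, r)` and `f` has derivative `f'` at `y`, then
`Σ_k k u_k y^k = y f'` (termwise differentiation, `hasDerivAt_tsum_of_isPreconnected`, and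
uniqueness of the derivative). [folklore] -/
theorem hasSum_mul_deriv {u : ℕ → ℝ} {f : ℝ → ℝ} {r f' y : ℝ} (hr : 0 < r)
    (hu : Summable fun k : ℕ => (k : ℝ) * |u k| * r ^ k)
    (hf : ∀ z ∈ Ioo (-r) r, HasSum (fun k : ℕ => u k * z ^ k) (f z))
    (hy : y ∈ Ioo (-r) r) (hf' : HasDerivAt f f' y) :
    HasSum (fun k : ℕ => (k : ℝ) * u k * y ^ k) (y * f') := by
  have hg : ∀ (k : ℕ) (z : ℝ), z ∈ Ioo (-r) r →
      HasDerivAt (fun x => u k * x ^ k) (u k * ((k : ℝ) * z ^ (k - 1))) z :=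
    fun k z _ => (hasDerivAt_pow k z).const_mul (u k)
  have hg' : ∀ (k : ℕ) (z : ℝ), z ∈ Ioo (-r) r →
      ‖u k * ((k : ℝ) * z ^ (k - 1))‖ ≤ (k : ℝ) * |u k| * r ^ k * r⁻¹ := by
    intro k z hz
    have hzr : |z| ≤ r := (abs_lt.mpr hz).le
    rw [Real.norm_eq_abs, abs_mul, abs_mul, abs_pow, Nat.abs_cast]
    rcases k with _ | k
    · simp
    · rw [Nat.add_sub_cancel]
      calc |u (k + 1)| * (((k + 1 : ℕ) : ℝ) * |z| ^ k)
          ≤ |u (k + 1)| * (((k + 1 : ℕ) : ℝ) * r ^ k) := by gcongr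
        _ = ((k + 1 : ℕ) : ℝ) * |u (k + 1)| * r ^ (k + 1) * r⁻¹ := by
          rw [pow_succ]
          field_simp
  have key := hasDerivAt_tsum_of_isPreconnected (hu.mul_right r⁻¹) isOpen_Ioo
    isPreconnected_Ioo hg hg' hy (hf y hy).summable hy
  have h1 : HasDerivAt f (∑' k, u k * ((k : ℝ) * y ^ (k - 1))) y :=
    key.congr_of_eventuallyEq (by
      filter_upwards [isOpen_Ioo.mem_nhds hy] with z hz using (hf z hz).tsum_eq.symm)
  have hS : Summable fun k => u k * ((k : ℝ) * y ^ (k - 1)) :=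
    .of_norm_bounded (hu.mul_right r⁻¹) fun k => hg' k y hy
  have h3 := hS.hasSum.mul_left y
  rw [← hf'.unique h1] at h3
  refine h3.congr_fun fun k => ?_
  rcases k with _ | k
  · simp
  · rw [Nat.add_sub_cancel, pow_succ]
    ring

/-! ### Evaluation of the face restrictions -/

/-- Face evaluation: `(bind₁ g R)(w) = R(v)` when `g(w) = v` componentwise. [folklore] -/
theorem aeval_bind₁_eq {g : Fin 2 → MvPolynomial (Fin 2) ℚ} {v w : Fin 2 → ℝ}
    (hv : (fun j => aeval w (g j)) = v) (R : MvPolynomial (Fin 2) ℚ) :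
    aeval w (bind₁ g R) = aeval v R := by
  rw [aeval_bind₁, hv]

/-- The face denominator at `(s, y)`: `(1 − ϖ·T∘g)(s, y) = 1 − y·T(v)`. [folklore] -/
theorem aeval_den {g : Fin 2 → MvPolynomial (Fin 2) ℚ} {v : Fin 2 → ℝ} {s y : ℝ}
    (hv : (fun j => aeval (![s, y] : Fin 2 → ℝ) (g j)) = v) (T : MvPolynomial (Fin 2) ℚ) :
    aeval (![s, y] : Fin 2 → ℝ) (1 - X 1 * bind₁ g T) = 1 - y * aeval v T := by
  rw [map_sub, map_one, map_mul, aeval_X, aeval_bind₁_eq hv]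
  simp

/-- `|yτ| < 1` when `|τ| ≤ M`, `|y| < r` and `rM < 1`. [folklore] -/
theorem abs_mul_lt_one {y τ M r : ℝ} (hM : |τ| ≤ M) (hy : |y| < r) (hrM : r * M < 1) :
    |y * τ| < 1 := by
  rw [abs_mul]
  exact lt_of_le_of_lt (mul_le_mul hy.le hM (abs_nonneg _) ((abs_nonneg y).trans hy.le)) hrM

/-- The face denominator does not vanish: `(1 − ϖ·T∘g)(s, y) ≠ 0` when `|T(v)| ≤ M`, `|y| < r`
and `rM < 1` (indeed `1 − yT(v) ≥ 1 − |yT(v)| > 0`). [folklore] -/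
theorem aeval_den_ne_zero {g : Fin 2 → MvPolynomial (Fin 2) ℚ} {v : Fin 2 → ℝ} {s y M r : ℝ}
    (hv : (fun j => aeval (![s, y] : Fin 2 → ℝ) (g j)) = v) {T : MvPolynomial (Fin 2) ℚ}
    (hM : |aeval v T| ≤ M) (hy : |y| < r) (hrM : r * M < 1) :
    aeval (![s, y] : Fin 2 → ℝ) (1 - X 1 * bind₁ g T) ≠ 0 := by
  rw [aeval_den hv]
  exact (sub_pos.mpr ((le_abs_self _).trans_lt (abs_mul_lt_one hM hy hrM))).ne'

/-! ### The power series of the levels of a one-face `θ`-tower -/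

/-- **Levels of a face tower are `Σ_k k^i c τ^k y^k`.** For the tower `N 0 = q·P∘g`,
`N (i+1) = ϖ(∂_ϖN_i · D − (i+1) N_i ∂_ϖD)`, `D = 1 − ϖ·T∘g` (face embedding `g` with
`g(s,y) = v` for all `y`), and `|T(v)| ≤ M`, `0 < r`, `rM < 1`: for every `y ∈ (−r, r)`,
`N_i/D^{i+1}(s, y) = Σ_k k^i · q P(v) T(v)^k · y^k` — level `0` is the geometric series and
level `i + 1 = y·∂_y(level i)` (quotient rule) is differentiated termwise. [folklore] -/
theorem hasSum_level (g : Fin 2 → MvPolynomial (Fin 2) ℚ) (s : ℝ) (v : Fin 2 → ℝ)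
    (hv : ∀ y : ℝ, (fun j => aeval (![s, y] : Fin 2 → ℝ) (g j)) = v)
    (q : ℕ) (T P : MvPolynomial (Fin 2) ℚ) (N : ℕ → MvPolynomial (Fin 2) ℚ)
    (hN0 : N 0 = C (q : ℚ) * bind₁ g P)
    (hNS : ∀ i, N (i + 1) = X 1 * (pderiv 1 (N i) * (1 - X 1 * bind₁ g T) -
        C ((i : ℚ) + 1) * N i * pderiv 1 (1 - X 1 * bind₁ g T)))
    {M r : ℝ} (hM : |aeval v T| ≤ M) (hr : 0 < r) (hrM : r * M < 1) (i : ℕ) :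
    ∀ y ∈ Ioo (-r) r,
      HasSum (fun k : ℕ => (k : ℝ) ^ i * ((q : ℝ) * aeval v P * (aeval v T) ^ k) * y ^ k)
        (aeval (![s, y] : Fin 2 → ℝ) (N i) /
          aeval (![s, y] : Fin 2 → ℝ) (1 - X 1 * bind₁ g T) ^ (i + 1)) := by
  induction i with
  | zero =>
    intro y hy
    have hyτ : |y * aeval v T| < 1 := abs_mul_lt_one hM (abs_lt.mpr hy) hrM
    rw [hN0, aeval_den (hv y), zero_add, pow_one, map_mul, aeval_C, aeval_bind₁_eq (hv y),
      eq_ratCast, Rat.cast_natCast, div_eq_mul_inv]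
    refine ((hasSum_geometric_of_abs_lt_one hyτ).mul_left ((q : ℝ) * aeval v P)).congr_fun
      fun k => ?_
    rw [pow_zero, one_mul, mul_pow]
    ring
  | succ i ih =>
    intro y hy
    set Dp : MvPolynomial (Fin 2) ℚ := 1 - X 1 * bind₁ g T with hDp
    have hD : aeval (![s, y] : Fin 2 → ℝ) Dp ≠ 0 :=
      aeval_den_ne_zero (hv y) hM (abs_lt.mpr hy) hrM
    -- the quotient rule and the recursion: `y · ∂_y(N_i/D^{i+1}) = N_{i+1}/D^{i+2}`
    obtain ⟨F', hF, hyF'⟩ : ∃ F' : ℝ,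
        HasDerivAt (fun z : ℝ => aeval (![s, z] : Fin 2 → ℝ) (N i) /
          aeval (![s, z] : Fin 2 → ℝ) Dp ^ (i + 1)) F' y ∧
        y * F' = aeval (![s, y] : Fin 2 → ℝ) (N (i + 1)) /
          aeval (![s, y] : Fin 2 → ℝ) Dp ^ (i + 1 + 1) :=
      ⟨_, (QhFaceMoments.hasDerivAt_aeval_right (N i) s y).fun_div
        ((QhFaceMoments.hasDerivAt_aeval_right Dp s y).fun_pow (i + 1)) (pow_ne_zero _ hD), by
        rw [hNS i]
        simp only [map_mul, map_sub, map_add, map_one, map_natCast, aeval_X,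
          Matrix.cons_val_one, Matrix.cons_val_zero, Nat.add_sub_cancel]
        field_simp
        push_cast
        ring⟩
    -- the derivative bound `Σ_k k·|k^i c τ^k|·r^k = |c| Σ_k k^{i+1} (|τ|r)^k < ∞`
    have hτM : |aeval v T| * r < 1 := lt_of_le_of_lt (by nlinarith) hrM
    have hu : Summable fun k : ℕ =>
        (k : ℝ) * |(k : ℝ) ^ i * ((q : ℝ) * aeval v P * (aeval v T) ^ k)| * r ^ k := by
      have hs := (summable_pow_mul_geometric_of_norm_lt_one (i + 1)
        (r := |aeval v T| * r) (by
          rw [Real.norm_of_nonneg (mul_nonneg (abs_nonneg _) hr.le)]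
          exact hτM)).mul_left |(q : ℝ) * aeval v P|
      refine hs.congr fun k => ?_
      simp only [abs_mul, abs_pow, Nat.abs_cast]
      ring
    have h := hasSum_mul_deriv hr hu ih hy hF
    rw [hyF'] at h
    exact h.congr_fun fun k => by ring

/-! ### The telescoping coefficients `e_{w,i}` -/

/-- `Σ_{i<#W} e_w.coeff i · x^i = ∏_{v∈W∖w} (x + (v+a+b))` for `w ∈ W`,
`e_w = ∏_{v∈W∖w} (X + (v+a+b))` (a monic polynomial of degree `#W − 1 < #W`). [folklore] -/
theorem sum_coeff_mul_pow {W : Finset ℕ} {w : ℕ} (hw : w ∈ W) (a b : ℕ) (x : ℚ) :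
    ∑ i ∈ Finset.range W.card,
      (∏ v ∈ W.erase w, (Polynomial.X + Polynomial.C ((v + a + b : ℕ) : ℚ))).coeff i * x ^ i =
      ∏ v ∈ W.erase w, (x + ((v + a + b : ℕ) : ℚ)) := by
  have hdeg : (∏ v ∈ W.erase w,
      (Polynomial.X + Polynomial.C ((v + a + b : ℕ) : ℚ))).natDegree < W.card := by
    rw [Polynomial.natDegree_prod_of_monic _ _ fun v _ => Polynomial.monic_X_add_C _]
    simp only [Polynomial.natDegree_X_add_C, Finset.sum_const, smul_eq_mul, mul_one,
      Finset.card_erase_of_mem hw]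
    exact Nat.sub_lt (Finset.card_pos.mpr ⟨w, hw⟩) one_pos
  rw [← Polynomial.eval_eq_sum_range' hdeg, Polynomial.eval_prod]
  simp only [Polynomial.eval_add, Polynomial.eval_X, Polynomial.eval_C]

/-- Real form of `sum_coeff_mul_pow` at `x = dk`:
`Σ_{i<#W} e_w.coeff i · (dk)^i = ∏_{v∈W∖w} ((v+a+b) + dk)`. [folklore] -/
theorem sum_coeff_mul_pow_real {W : Finset ℕ} {w : ℕ} (hw : w ∈ W) (a b d k : ℕ) :
    ∑ i ∈ Finset.range W.card,
      (((∏ v ∈ W.erase w, (Polynomial.X + Polynomial.C ((v + a + b : ℕ) : ℚ))).coeff i : ℚ) :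
          ℝ) * ((d : ℝ) * k) ^ i =
      ∏ v ∈ W.erase w, (((v + a + b : ℕ) : ℝ) + (d : ℝ) * k) := by
  have h := congrArg (fun x : ℚ => (x : ℝ)) (sum_coeff_mul_pow hw a b ((d : ℚ) * k))
  simp only [Rat.cast_sum, Rat.cast_mul, Rat.cast_pow, Rat.cast_prod, Rat.cast_add,
    Rat.cast_natCast] at h
  rw [h]
  exact Finset.prod_congr rfl fun v _ => add_comm _ _

/-- **Resummation of the telescoped series term.**
`Σ_w Σ_{i<#W} e_{w,i} d^i (k^i A_w τa_w^k ϖ^k + k^i B_w τb_w^k ϖ^k)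
  = ϖ^k Σ_w (∏_{v≠w}((v+a+b) + dk)) (A_w τa_w^k + B_w τb_w^k)`. [folklore] -/
theorem expand_eq (W : Finset ℕ) (a b d k : ℕ) (A B τa τb : ℕ → ℝ) (ϖ : ℝ) :
    ∑ w ∈ W, ∑ i ∈ Finset.range W.card,
      (((∏ v ∈ W.erase w, (Polynomial.X + Polynomial.C ((v + a + b : ℕ) : ℚ))).coeff i : ℚ) :
          ℝ) * (d : ℝ) ^ i *
        ((k : ℝ) ^ i * (A w * τa w ^ k) * ϖ ^ k + (k : ℝ) ^ i * (B w * τb w ^ k) * ϖ ^ k) =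
      ϖ ^ k * ∑ w ∈ W, (∏ v ∈ W.erase w, (((v + a + b : ℕ) : ℝ) + (d : ℝ) * k)) *
        (A w * τa w ^ k + B w * τb w ^ k) := by
  rw [Finset.mul_sum]
  refine Finset.sum_congr rfl fun w hw => ?_
  rw [← sum_coeff_mul_pow_real hw a b d k, Finset.sum_mul, Finset.mul_sum]
  refine Finset.sum_congr rfl fun i _ => ?_
  ring

/-- **Summable majorant.** The sequence `ϖ^k Σ_w (∏_{v≠w}((v+a+b) + dk)) (c_w M^k)` is summable
when `‖Mϖ‖ < 1`: it is a finite combination of the summable sequences `k^i (Mϖ)^k`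
(`Σ_i e_{w,i}(dk)^i = ∏_{v≠w}((v+a+b) + dk)`). [folklore] -/
theorem summable_bound (W : Finset ℕ) (a b d : ℕ) (c : ℕ → ℝ) {M ϖ : ℝ} (hq : ‖M * ϖ‖ < 1) :
    Summable fun k : ℕ => ϖ ^ k * ∑ w ∈ W,
      (∏ v ∈ W.erase w, (((v + a + b : ℕ) : ℝ) + (d : ℝ) * k)) * (c w * M ^ k) := by
  have hBs : Summable fun k : ℕ => ∑ w ∈ W, ∑ i ∈ Finset.range W.card,
      (((∏ v ∈ W.erase w, (Polynomial.X + Polynomial.C ((v + a + b : ℕ) : ℚ))).coeff i : ℚ) :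
          ℝ) * (d : ℝ) ^ i * c w * ((k : ℝ) ^ i * (M * ϖ) ^ k) :=
    summable_sum fun w _ => summable_sum fun i _ =>
      (summable_pow_mul_geometric_of_norm_lt_one i hq).mul_left _
  refine hBs.congr fun k => ?_
  rw [Finset.mul_sum]
  refine Finset.sum_congr rfl fun w hw => ?_
  rw [← sum_coeff_mul_pow_real hw a b d k, Finset.sum_mul, Finset.mul_sum]
  refine Finset.sum_congr rfl fun i _ => ?_
  ring

end FaceSeriesVanishing

/-- STUB `stub_faceSeriesVanishing` (wave 15, real analysis). **The telescoped face family has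
vanishing integrals near the Tate point.** With the one-face `θ`-towers `NAs` (denominator
`D_a = 1 − ϖT(1,s)`, seed `aP_w(1,s)`) and `NBs` (denominator `D_b = 1 − ϖT(s,1)`, seed
`bP_w(s,1)`) at the `(s,ϖ)`-level (`X 0 = s`, `X 1 = ϖ`), and the vanishing face moments of
`stub_qhFaceMoments`, there is `b₁ > 0` such that for `ϖ ∈ (0,b₁)` both face denominators are
non-zero on `[0,1]` and
`∫₀¹ Σ_{w∈W} Σ_{i<#W} e_{w,i} d^i [NAs w i/D_a^{i+1} + NBs w i/D_b^{i+1}](s,ϖ) ds = 0`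
(`e_w = ∏_{v∈W∖w}(X + (v+a+b))`). Proof: with `M ≥ |T(1,s)|, |T(s,1)|` on `[0,1]` and
`b₁ = 1/(M+1)`, level `i` of a face tower is `Σ_k k^i·aP_w(1,s)T(1,s)^k ϖ^k` on `(−b₁, b₁)`
(`FaceSeriesVanishing.hasSum_level`: geometric series, then `level (i+1) = ϖ∂_ϖ(level i)`
differentiated termwise); `Σ_i e_{w,i}(dk)^i = ∏_{v≠w}((v+a+b) + dk)`
(`FaceSeriesVanishing.expand_eq`), so the integrand is `Σ_k ϖ^k H_k(s)` with `H_k` the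
integrand of the `k`-th face moment, dominated by the summable
`ϖ^k M^k Σ_w (∏_{v≠w}((v+a+b)+dk))(aK_w + bK_w)`; termwise integration
(`intervalIntegral.hasSum_integral_of_dominated_convergence`) gives `Σ_k ϖ^k·0 = 0`.
[folklore] -/
theorem stub_faceSeriesVanishing (a b d : ℕ) (T : MvPolynomial (Fin 2) ℚ) (W : Finset ℕ)
    (Pw : ℕ → MvPolynomial (Fin 2) ℚ) (NAs NBs : ℕ → ℕ → MvPolynomial (Fin (1 + 1)) ℚ)
    (hNA0 : ∀ w, NAs w 0 = C (a : ℚ) * bind₁ ![C 1, X 0] (Pw w))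
    (hNAS : ∀ w i, NAs w (i + 1) =
      X 1 * (pderiv 1 (NAs w i) * (1 - X 1 * bind₁ ![C 1, X 0] T) -
        C ((i : ℚ) + 1) * NAs w i * pderiv 1 (1 - X 1 * bind₁ ![C 1, X 0] T)))
    (hNB0 : ∀ w, NBs w 0 = C (b : ℚ) * bind₁ ![X 0, C 1] (Pw w))
    (hNBS : ∀ w i, NBs w (i + 1) =
      X 1 * (pderiv 1 (NBs w i) * (1 - X 1 * bind₁ ![X 0, C 1] T) -
        C ((i : ℚ) + 1) * NBs w i * pderiv 1 (1 - X 1 * bind₁ ![X 0, C 1] T)))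
    (hmomf : ∀ k : ℕ, ∫ s in (0 : ℝ)..1, ∑ w ∈ W,
      (∏ v ∈ W.erase w, (((v + a + b : ℕ) : ℝ) + (d : ℝ) * k)) *
        ((a : ℝ) * aeval (![1, s] : Fin 2 → ℝ) (Pw w * T ^ k) +
          (b : ℝ) * aeval (![s, 1] : Fin 2 → ℝ) (Pw w * T ^ k)) = 0) :
    ∃ b₁ : ℝ, 0 < b₁ ∧ ∀ ϖ ∈ Ioo (0 : ℝ) b₁,
      (∀ s ∈ Icc (0 : ℝ) 1,
        aeval (![s, ϖ] : Fin 2 → ℝ) (1 - X 1 * bind₁ ![C 1, X 0] T : MvPolynomial (Fin (1 + 1)) ℚ) ≠ 0 ∧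
        aeval (![s, ϖ] : Fin 2 → ℝ) (1 - X 1 * bind₁ ![X 0, C 1] T : MvPolynomial (Fin (1 + 1)) ℚ) ≠ 0) ∧
      ∫ s in (0 : ℝ)..1, ∑ w ∈ W, ∑ i ∈ Finset.range W.card,
        (((∏ v ∈ W.erase w, (Polynomial.X + Polynomial.C ((v + a + b : ℕ) : ℚ))).coeff i : ℚ) : ℝ) * (d : ℝ) ^ i *
          (aeval (![s, ϖ] : Fin 2 → ℝ) (NAs w i) /
              aeval (![s, ϖ] : Fin 2 → ℝ) (1 - X 1 * bind₁ ![C 1, X 0] T : MvPolynomial (Fin (1 + 1)) ℚ) ^ (i + 1) +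
            aeval (![s, ϖ] : Fin 2 → ℝ) (NBs w i) /
              aeval (![s, ϖ] : Fin 2 → ℝ) (1 - X 1 * bind₁ ![X 0, C 1] T : MvPolynomial (Fin (1 + 1)) ℚ) ^ (i + 1)) = 0 := by
  -- uniform bounds of the two face slices of a polynomial on `[0,1]` (continuity, compactness)
  have hbd : ∀ R : MvPolynomial (Fin 2) ℚ, ∃ K : ℝ, 0 ≤ K ∧
      (∀ s ∈ Icc (0 : ℝ) 1, |aeval (![1, s] : Fin 2 → ℝ) R| ≤ K) ∧
      ∀ s ∈ Icc (0 : ℝ) 1, |aeval (![s, 1] : Fin 2 → ℝ) R| ≤ K := by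
    intro R
    have hc₁ : Continuous fun s : ℝ => aeval (![1, s] : Fin 2 → ℝ) R :=
      QhFaceMoments.continuous_aeval_vec continuous_const continuous_id R
    have hc₂ : Continuous fun s : ℝ => aeval (![s, 1] : Fin 2 → ℝ) R :=
      QhFaceMoments.continuous_aeval_vec continuous_id continuous_const R
    obtain ⟨K₁, h₁⟩ := (isCompact_Icc : IsCompact (Icc (0 : ℝ) 1)).exists_bound_of_continuousOn
      hc₁.continuousOn
    obtain ⟨K₂, h₂⟩ := (isCompact_Icc : IsCompact (Icc (0 : ℝ) 1)).exists_bound_of_continuousOn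
      hc₂.continuousOn
    exact ⟨|K₁| + |K₂|, by positivity,
      fun s hs => ((Real.norm_eq_abs _).symm.trans_le (h₁ s hs)).trans
        ((le_abs_self K₁).trans (le_add_of_nonneg_right (abs_nonneg _))),
      fun s hs => ((Real.norm_eq_abs _).symm.trans_le (h₂ s hs)).trans
        ((le_abs_self K₂).trans (le_add_of_nonneg_left (abs_nonneg _)))⟩
  obtain ⟨M, hM0, hTa, hTb⟩ := hbd T
  choose K hK0 hKa hKb using fun w => hbd (Pw w)
  -- the radius `b₁ = r = 1/(M+1)`
  set r : ℝ := 1 / (M + 1) with hr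
  have hr0 : 0 < r := one_div_pos.mpr (by linarith)
  have hrM : r * M < 1 := by
    rw [hr, one_div_mul_eq_div, div_lt_one (by linarith)]
    exact lt_add_one M
  -- the two face embeddings
  have hva : ∀ s y : ℝ, (fun j => aeval (![s, y] : Fin 2 → ℝ)
      ((![C 1, X 0] : Fin 2 → MvPolynomial (Fin 2) ℚ) j)) = ![1, s] := fun s y => by
    funext j
    fin_cases j <;> simp
  have hvb : ∀ s y : ℝ, (fun j => aeval (![s, y] : Fin 2 → ℝ)
      ((![X 0, C 1] : Fin 2 → MvPolynomial (Fin 2) ℚ) j)) = ![s, 1] := fun s y => by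
    funext j
    fin_cases j <;> simp
  refine ⟨r, hr0, fun ϖ hϖ => ?_⟩
  have hϖr : ϖ ∈ Ioo (-r) r := ⟨by linarith [hϖ.1], hϖ.2⟩
  refine ⟨fun s hs =>
    ⟨FaceSeriesVanishing.aeval_den_ne_zero (hva s ϖ) (hTa s hs) (abs_lt.mpr hϖr) hrM,
      FaceSeriesVanishing.aeval_den_ne_zero (hvb s ϖ) (hTb s hs) (abs_lt.mpr hϖr) hrM⟩, ?_⟩
  -- the face-moment integrands `H_k` and their continuity
  set H : ℕ → ℝ → ℝ := fun k s => ∑ w ∈ W,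
    (∏ v ∈ W.erase w, (((v + a + b : ℕ) : ℝ) + (d : ℝ) * k)) *
      ((a : ℝ) * aeval (![1, s] : Fin 2 → ℝ) (Pw w * T ^ k) +
        (b : ℝ) * aeval (![s, 1] : Fin 2 → ℝ) (Pw w * T ^ k)) with hH
  have hmomf' : ∀ k, ∫ s in (0 : ℝ)..1, H k s = 0 := hmomf
  have hHc : ∀ k, Continuous (H k) := fun k =>
    continuous_finsetSum _ fun w _ =>
      (((QhFaceMoments.continuous_aeval_vec continuous_const continuous_id _).const_mul
        _).fun_add ((QhFaceMoments.continuous_aeval_vec continuous_id continuous_const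
          _).const_mul _)).const_mul _
  have hq : ‖M * ϖ‖ < 1 := by
    rw [Real.norm_of_nonneg (mul_nonneg hM0 hϖ.1.le)]
    exact lt_of_le_of_lt (by nlinarith [hϖ.2]) hrM
  -- termwise integration: `∫ Σ_k ϖ^k H_k = Σ_k ϖ^k ∫ H_k = 0`
  refine HasSum.unique (L := SummationFilter.unconditional ℕ) (f := fun _ : ℕ => (0 : ℝ)) ?_
    hasSum_zero
  have hF0 : (fun _ : ℕ => (0 : ℝ)) = fun k : ℕ => ∫ s in (0 : ℝ)..1, ϖ ^ k * H k s := by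
    funext k
    rw [intervalIntegral.integral_const_mul, hmomf' k, mul_zero]
  rw [hF0]
  refine intervalIntegral.hasSum_integral_of_dominated_convergence
    (fun k _ => ϖ ^ k * ∑ w ∈ W, (∏ v ∈ W.erase w, (((v + a + b : ℕ) : ℝ) + (d : ℝ) * k)) *
      (((a : ℝ) * K w + (b : ℝ) * K w) * M ^ k))
    (fun k => (continuous_const.mul (hHc k)).aestronglyMeasurable) (fun k => ?_) ?_ ?_ ?_
  · -- the domination `|ϖ^k H_k| ≤ ϖ^k Σ_w (∏_{v≠w}(λ_v + dk)) (aK_w + bK_w) M^k` on `(0,1]`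
    refine Filter.Eventually.of_forall fun s hs => ?_
    rw [Set.uIoc_of_le zero_le_one] at hs
    have hs' : s ∈ Icc (0 : ℝ) 1 := Ioc_subset_Icc_self hs
    rw [norm_mul, norm_pow, Real.norm_of_nonneg hϖ.1.le, Real.norm_eq_abs]
    refine mul_le_mul_of_nonneg_left ((Finset.abs_sum_le_sum_abs _ _).trans
      (Finset.sum_le_sum fun w _ => ?_)) (pow_nonneg hϖ.1.le k)
    have hE : 0 ≤ ∏ v ∈ W.erase w, (((v + a + b : ℕ) : ℝ) + (d : ℝ) * k) :=
      Finset.prod_nonneg fun v _ => by positivity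
    have hx : |(a : ℝ) * aeval (![1, s] : Fin 2 → ℝ) (Pw w * T ^ k)| ≤ (a : ℝ) * K w * M ^ k := by
      rw [map_mul, map_pow, ← mul_assoc, abs_mul, abs_mul, abs_pow, Nat.abs_cast]
      exact mul_le_mul (mul_le_mul_of_nonneg_left (hKa w s hs') (Nat.cast_nonneg a))
        (pow_le_pow_left₀ (abs_nonneg _) (hTa s hs') k) (pow_nonneg (abs_nonneg _) k)
        (mul_nonneg (Nat.cast_nonneg a) (hK0 w))
    have hy : |(b : ℝ) * aeval (![s, 1] : Fin 2 → ℝ) (Pw w * T ^ k)| ≤ (b : ℝ) * K w * M ^ k := by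
      rw [map_mul, map_pow, ← mul_assoc, abs_mul, abs_mul, abs_pow, Nat.abs_cast]
      exact mul_le_mul (mul_le_mul_of_nonneg_left (hKb w s hs') (Nat.cast_nonneg b))
        (pow_le_pow_left₀ (abs_nonneg _) (hTb s hs') k) (pow_nonneg (abs_nonneg _) k)
        (mul_nonneg (Nat.cast_nonneg b) (hK0 w))
    rw [abs_mul, abs_of_nonneg hE]
    calc _ ≤ (∏ v ∈ W.erase w, (((v + a + b : ℕ) : ℝ) + (d : ℝ) * k)) *
          ((a : ℝ) * K w * M ^ k + (b : ℝ) * K w * M ^ k) :=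
          mul_le_mul_of_nonneg_left ((abs_add_le _ _).trans (add_le_add hx hy)) hE
      _ = _ := by ring
  · -- summability of the majorant
    exact Filter.Eventually.of_forall fun s _ =>
      FaceSeriesVanishing.summable_bound W a b d (fun w => (a : ℝ) * K w + (b : ℝ) * K w) hq
  · exact intervalIntegrable_const
  · -- the pointwise expansion `Σ_k ϖ^k H_k(s) = Σ_w Σ_i e_{w,i} d^i (level_a + level_b)(s, ϖ)`
    refine Filter.Eventually.of_forall fun s hs => ?_
    rw [Set.uIoc_of_le zero_le_one] at hs
    have hs' : s ∈ Icc (0 : ℝ) 1 := Ioc_subset_Icc_self hs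
    have h := hasSum_sum fun w (_ : w ∈ W) => hasSum_sum fun i (_ : i ∈ Finset.range W.card) =>
      ((FaceSeriesVanishing.hasSum_level ![C 1, X 0] s ![1, s] (hva s) a T (Pw w) (NAs w)
          (hNA0 w) (hNAS w) (hTa s hs') hr0 hrM i ϖ hϖr).add
        (FaceSeriesVanishing.hasSum_level ![X 0, C 1] s ![s, 1] (hvb s) b T (Pw w) (NBs w)
          (hNB0 w) (hNBS w) (hTb s hs') hr0 hrM i ϖ hϖr)).mul_left
        ((((∏ v ∈ W.erase w, (Polynomial.X + Polynomial.C ((v + a + b : ℕ) : ℚ))).coeff i :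
          ℚ) : ℝ) * (d : ℝ) ^ i)
    refine h.congr_fun fun k => ?_
    rw [FaceSeriesVanishing.expand_eq]
    simp only [hH, map_mul, map_pow, mul_assoc]

end Summit.KontsevichZagierPeriods.InverseLandau.TateFamilyKernel.Descent
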